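import Summits.FinalStateConjecture.FinalStateConjecture.Theorems.InertialRecession.Negative.CesaroShadow

/-!
# Negative knowledge for the crux `InertialRecession` (route EIHFluxBalance, item
stmt-FinalStateConjecture-17403 — the rev-6 restatement of stmt-10166): the quasi-stationarity
clause (QS) added to the antecedent does not change the load-bearing analysis — RATES SHORT OF
INTEGRABILITY FREEZE NOTHING

Refuter file (D-0016 negative lane, `--supports stmt-FinalStateConjecture-17403`). No Theses decl is
asserted. Context: the restated crux appends to its antecedent the handoff clause (QS), the
`(1 + d^{7/4})`-weighted quasi-stationarity of the painted background in the cone `|x̲| ≤ κt`. For an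
isolated painted hole the weight at `d ≍ t` turns (QS) into a RATE on the painted moduli,
`t^{3/4} ‖(Λᵢ e₀)˙(t)‖ → 0` (the route's own necessity analysis, `…StubWeightedRatesNecessityQS`),
hence — once the painted boost is slaved to the centre — `t^{3/4} |ξᵢ''(t)| → 0`. This file records
that such a rate is worthless for the conclusion by itself:

* the RATED KINEMATIC SHADOW of the restated crux for one centre along one axis (stated inline in
  the two theorems; no definition is introduced): the clauses of `InertialRecessionWithoutFieldEquationsCesaro`
  (`Negative/CesaroShadow.lean`) with the rate-free decay of `ξ''`, `ξ'''` STRENGTHENED to the power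
  rates `t^s ξ''(t) → 0`, `t^s ξ'''(t) → 0` for EVERY `s < 1` (so in particular the (QS)-rate
  `s = 3/4`), and the weakest conclusion the typed `FinalStateDecomposition` needs, a Cesàro velocity
  `ξ(t)/t → V`;
* `inertialRecession_false_without_fieldEquations_rated` (Cesàro conclusion) and
  `inertialRecession_false_without_fieldEquations_rated_frozen` (instantaneous conclusion): both
  shadows are FALSE — the SAME witness `centre (1/4)` of `Negative/KinematicShadow.lean` (`ξ' = cos(log(1+t²)/2)/4`,
  `|ξ''| ≤ 1/(4t)`, `|ξ'''| ≤ 1/(2t)`): every power rate `s < 1` holds, the Cesàro mean still wanders;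
* the rated shadows are implied by the rate-free ones (power rates imply plain decay, `s = 0`), so
  these refutations SUBSUME `inertialRecession_false_without_fieldEquations_cesaro` and
  `inertialRecession_false_without_fieldEquations` (the two closing `example`s).

Reading for provers: with (QS) in hand the freezing input is still an INTEGRABLE force
(`tendsto_of_integrableOn_deriv`, `Negative/KinematicShadow.lean`); `o(t^{-3/4})` — indeed any `o(t^{-s})`,
`s < 1` — on accelerations is not, and the crux's own "why it might fail" line ("even given QS the
quadratic LL flux `ε(t)² r_b^{-3/2}` carries no rate") is exactly this gap. Standing disprover's work
file: `Summits/FinalStateConjecture/FinalStateConjecture/Cruxes/InertialRecession/Disproof.lean` (§J).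
-/

set_option linter.dupNamespace false

noncomputable section

namespace Summit.FinalStateConjecture.FinalStateConjecture.Theorems.InertialRecession.Negative

open Filter Set MeasureTheory intervalIntegral
open scoped Topology

/-- A function bounded by `C/t` after time `1` is `o(t^{-s})` for every `s < 1`:
`t^s |f t| ≤ C t^{s-1} → 0`. [folklore] -/
theorem tendsto_rpow_mul_of_abs_le_inv {f : ℝ → ℝ} {C : ℝ} (hf : ∀ t, 1 ≤ t → |f t| ≤ C * t⁻¹)
    {s : ℝ} (hs : s < 1) : Tendsto (fun t ↦ t ^ s * f t) atTop (𝓝 0) := by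
  have hlim : Tendsto (fun t : ℝ ↦ C * t ^ (s - 1)) atTop (𝓝 0) := by
    have h := (tendsto_rpow_neg_atTop (by linarith : 0 < 1 - s)).const_mul C
    rw [mul_zero] at h
    convert h using 2
    rw [neg_sub]
  refine squeeze_zero_norm' ?_ hlim
  filter_upwards [eventually_ge_atTop 1] with t ht
  have ht0 : 0 < t := by linarith
  rw [Real.norm_eq_abs, abs_mul, abs_of_nonneg (Real.rpow_nonneg ht0.le s)]
  calc t ^ s * |f t| ≤ t ^ s * (C * t⁻¹) := mul_le_mul_of_nonneg_left (hf t ht) (Real.rpow_nonneg ht0.le s)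
    _ = C * t ^ (s - 1) := by
        rw [Real.rpow_sub_one ht0.ne']; ring

/-- The witness's acceleration is `o(t^{-s})` for every `s < 1` (from `|ξ''| ≤ |c|/t`). [folklore] -/
theorem tendsto_rpow_mul_deriv2_centre (c : ℝ) {s : ℝ} (hs : s < 1) :
    Tendsto (fun t ↦ t ^ s * deriv^[2] (centre c) t) atTop (𝓝 0) :=
  tendsto_rpow_mul_of_abs_le_inv (fun t ht ↦ abs_deriv2_centre_le c (by linarith)) hs

/-- The witness's jerk is `o(t^{-s})` for every `s < 1` (from `|ξ'''| ≤ 2|c|/t`, `t ≥ 1`). [folklore] -/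
theorem tendsto_rpow_mul_deriv3_centre (c : ℝ) {s : ℝ} (hs : s < 1) :
    Tendsto (fun t ↦ t ^ s * deriv^[3] (centre c) t) atTop (𝓝 0) := by
  refine tendsto_rpow_mul_of_abs_le_inv (C := 2 * |c|) (fun t ht ↦ ?_) hs
  rw [deriv3_centre, abs_mul]
  calc |c| * |jerk t| ≤ |c| * (2 * t⁻¹) := mul_le_mul_of_nonneg_left (abs_jerk_le ht) (abs_nonneg c)
    _ = 2 * |c| * t⁻¹ := by ring

/-- **(QS)-type rates do not rescue the kinematic route — Cesàro form.** The RATED KINEMATIC SHADOW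
of the restated crux (item 17403) for one modulated centre `ξ` along one axis — `C^∞`, eventually
inside the cone `κ² t`, `0 < κ < 1`, speed `≤ κ²`, and the power rates `t^s ξ''(t) → 0`,
`t^s ξ⁽³⁾(t) → 0` for EVERY `s < 1` (the weighted quasi-stationarity clause (QS) can give `s = 3/4`
for a slaved isolated hole; the field equations are dropped) — does NOT give a Cesàro velocity
`ξ(t)/t → V` (the one asymptotic datum per hole the typed `FinalStateDecomposition` needs). Witness
`centre (1/4)` of `KinematicShadow.lean` (speed `≤ 1/4 = κ²`, `κ = 1/2`; `|ξ''| ≤ 1/(4t)`,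
`|ξ⁽³⁾| ≤ 1/(2t)`, both `o(t^{-s})` for all `s < 1`; Cesàro mean frequently near `1/8` and near
`-1/8`). Any proof of the restated crux must still turn the field equations into an INTEGRABLE
momentum balance (`tendsto_of_integrableOn_deriv`); a power rate short of integrability is no
substitute. [folklore]
[topic: Summits/FinalStateConjecture/FinalStateConjecture — multi-black-hole kinematics, crux InertialRecession] -/
theorem inertialRecession_false_without_fieldEquations_rated :
    ¬ ∀ (κ : ℝ) (ξ : ℝ → ℝ), ContDiff ℝ ((⊤ : ℕ∞) : WithTop ℕ∞) ξ → 0 < κ → κ < 1 →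
      (∀ᶠ t in atTop, |ξ t| ≤ κ ^ 2 * t) → (∀ t, |deriv ξ t| ≤ κ ^ 2) →
        (∀ s : ℝ, s < 1 → Tendsto (fun t ↦ t ^ s * deriv^[2] ξ t) atTop (𝓝 0)) →
          (∀ s : ℝ, s < 1 → Tendsto (fun t ↦ t ^ s * deriv^[3] ξ t) atTop (𝓝 0)) →
            ∃ V : ℝ, Tendsto (fun t ↦ ξ t / t) atTop (𝓝 V) := fun h ↦
  not_tendsto_centre_div (by norm_num : (1 / 4 : ℝ) ≠ 0)
    (h (1 / 2) _ (contDiff_centre _) (by norm_num) (by norm_num) eventually_abs_centre_le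
      abs_deriv_centre_le (fun _ hs ↦ tendsto_rpow_mul_deriv2_centre _ hs)
      (fun _ hs ↦ tendsto_rpow_mul_deriv3_centre _ hs))

/-- **(QS)-type rates do not rescue the kinematic route — frozen form.** Same rated kinematic shadow,
conclusion = the lab velocity `ξ'(t)` converges (what constant motions in the conclusion's
decomposition force): FALSE by the same witness (`ξ' = ± 1/4` at arbitrarily late times). [folklore]
[topic: Summits/FinalStateConjecture/FinalStateConjecture — multi-black-hole kinematics, crux InertialRecession] -/
theorem inertialRecession_false_without_fieldEquations_rated_frozen :
    ¬ ∀ (κ : ℝ) (ξ : ℝ → ℝ), ContDiff ℝ ((⊤ : ℕ∞) : WithTop ℕ∞) ξ → 0 < κ → κ < 1 →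
      (∀ᶠ t in atTop, |ξ t| ≤ κ ^ 2 * t) → (∀ t, |deriv ξ t| ≤ κ ^ 2) →
        (∀ s : ℝ, s < 1 → Tendsto (fun t ↦ t ^ s * deriv^[2] ξ t) atTop (𝓝 0)) →
          (∀ s : ℝ, s < 1 → Tendsto (fun t ↦ t ^ s * deriv^[3] ξ t) atTop (𝓝 0)) →
            ∃ v : ℝ, Tendsto (deriv ξ) atTop (𝓝 v) := fun h ↦
  not_tendsto_deriv_centre (by norm_num : (1 / 4 : ℝ) ≠ 0)
    (h (1 / 2) _ (contDiff_centre _) (by norm_num) (by norm_num) eventually_abs_centre_le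
      abs_deriv_centre_le (fun _ hs ↦ tendsto_rpow_mul_deriv2_centre _ hs)
      (fun _ hs ↦ tendsto_rpow_mul_deriv3_centre _ hs))

/-- Sanity: the rated refutation recovers the landed rate-free Cesàro refutation (power rates imply
plain decay, `s = 0`). -/
example : ¬ InertialRecessionWithoutFieldEquationsCesaro := fun h ↦
  inertialRecession_false_without_fieldEquations_rated fun κ ξ hξ hκ hκ1 hcone hspeed h2 h3 ↦
    h κ ξ hξ hκ hκ1 hcone hspeed (by simpa using h2 0 zero_lt_one) (by simpa using h3 0 zero_lt_one)

/-- Sanity: … and the landed frozen-shadow refutation. -/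
example : ¬ InertialRecessionWithoutFieldEquations := fun h ↦
  inertialRecession_false_without_fieldEquations_rated_frozen fun κ ξ hξ hκ hκ1 hcone hspeed h2 h3 ↦
    h κ ξ hξ hκ hκ1 hcone hspeed (by simpa using h2 0 zero_lt_one) (by simpa using h3 0 zero_lt_one)

end Summit.FinalStateConjecture.FinalStateConjecture.Theorems.InertialRecession.Negative

end
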